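import Summits.ABC.ABC.Theorems.TwistAmplificationSharpModerateLawCuspDispersionResolvedDefs
import Literature.NumberTheory.QuadraticFields.LenstraPomeranceCoprimePairs

/-!
# Crux `TwistAmplification.SharpModerateLaw` (stmt-ABC-1975), line `deep-moduli-cusp-dispersion`:
the resolved regime reduces to its conductor-free class sum

`lawOn_resolvedRegimeTw_of_missing : ResolvedMissingTw → LawOn ResolvedRegimeTw` (registered sub-goal of
stmt-ABC-1975): every pair `x = (u, v)` of the dyadic cusp set `cuspSetD X Y` in the twist-aware resolved
regime lies in the class `resolvedClass e g X Y` of its own datum `(e, g)`, where, with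
`Δ = (u³ − v²)/1728 ≠ 0`,

* `g` is the `u`-part of `|Δ|` (`∏_{p ∣ Δ, p ∣ u} p^{v_p(Δ)}`), so that `Δ = g·c` with `(u, c) = 1`;
* `e` is the powerful part of `|c|` (`∏_{p² ∣ c} p^{v_p(c)}`), and `|c| = e·r` with `r = ∏_{p ∥ c} p`.

The two archimedean class inequalities follow from `r' = simpleRad x ≤ r` (every prime `p ∥ u³ − v²` is
`≠ 2, 3`, is prime to `u`, hence divides `c` exactly once) and from
`r·rad e·(rad g)² ≤ N* = (∏_{p ∣ Δ, p ∣ u} p²)·(∏_{p ∣ Δ, p ∤ u} p)`; and `1 ≤ e, g ≤ |Δ| ≤ Y`.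
Hence the resolved set injects into `⋃_{e ≤ Y powerful} ⋃_{g ≤ Y} resolvedClass e g X Y` (a finite union:
every class lies in the conductor-free cusp box, itself inside `cuspSetD (Y²) Y`), its cardinality is at
most the double class sum, and the constant of `ResolvedMissingTw` works verbatim.

Contents: §1 generic arithmetic (splitting `n` along a set of primes, `|D| = 1728·|Δ|`), §2 the datum of a
pair (`datum_arith`), §3 finiteness of the cusp box and class membership, §4 the counting and the theorem.
The prime support of an `S`-part `∏_{p ∈ S} p^{v_p(m)}` is taken from the Literature
(`BinaryQuadraticForm.primeFactors_prod_pow_factorization`, Lenstra–Pomerance coprime pairs file).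
-/

noncomputable section

set_option linter.dupNamespace false

namespace Summit.ABC.ABC.Theorems.SharpModerateLaw.CuspDispersion

open scoped BigOperators

open Literature.NumberTheory.QuadraticFields.BinaryQuadraticForm
  (primeFactors_prod_pow_factorization)

/-! ## 1. Generic arithmetic -/

/-- Splitting `n ≠ 0` along a set of primes: `n = (∏_{p ∣ n, P p} p^{v_p(n)})·(∏_{p ∣ n, ¬P p} p^{v_p(n)})`. -/
theorem prod_primeFactors_filter_mul {n : ℕ} (hn : n ≠ 0) (P : ℕ → Prop) [DecidablePred P] :
    (∏ p ∈ n.primeFactors.filter P, p ^ n.factorization p) *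
      (∏ p ∈ n.primeFactors.filter (fun p => ¬ P p), p ^ n.factorization p) = n := by
  have h := Nat.prod_factorization_pow_eq_self hn
  rw [Finsupp.prod, Nat.support_factorization] at h
  rw [Finset.prod_filter_mul_prod_filter_not]
  exact h

/-- A prime `≠ 2, 3` dividing `1728·Δ` divides `Δ`. -/
theorem dvd_of_dvd_mul_1728 {p : ℕ} (hp : p.Prime) (hp2 : p ≠ 2) (hp3 : p ≠ 3) {Δ : ℤ}
    (h : (p : ℤ) ∣ 1728 * Δ) : (p : ℤ) ∣ Δ := by
  have hc2 : Nat.Coprime p 2 := (Nat.coprime_primes hp Nat.prime_two).mpr hp2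
  have hc3 : Nat.Coprime p 3 := (Nat.coprime_primes hp Nat.prime_three).mpr hp3
  have hc : Nat.Coprime p 1728 := by
    have h1728 : (1728 : ℕ) = 2 ^ 6 * 3 ^ 3 := by norm_num
    rw [h1728]
    exact Nat.Coprime.mul_right (Nat.Coprime.pow_right _ hc2) (Nat.Coprime.pow_right _ hc3)
  have hcop : IsCoprime (p : ℤ) 1728 := Int.isCoprime_iff_gcd_eq_one.mpr (by exact_mod_cast hc)
  exact hcop.dvd_of_dvd_mul_left h

/-- A prime dividing `u³ − v²` exactly once does not divide `u`
(`p ∣ u`, `p ∣ u³ − v²` force `p ∣ v`, hence `p² ∣ u³ − v²`). -/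
theorem not_dvd_of_simple {u v : ℤ} {p : ℕ} (hp : p.Prime) (h1 : (p : ℤ) ∣ u ^ 3 - v ^ 2)
    (h2 : ¬ (p : ℤ) ^ 2 ∣ u ^ 3 - v ^ 2) : ¬ (p : ℤ) ∣ u := by
  intro hpu
  apply h2
  have hp' : Prime (p : ℤ) := Nat.prime_iff_prime_int.mp hp
  have hu3 : (p : ℤ) ∣ u ^ 3 := dvd_pow hpu (by norm_num)
  have hv2 : (p : ℤ) ∣ v ^ 2 := by
    have := dvd_sub hu3 h1
    rwa [sub_sub_cancel] at this
  have hv : (p : ℤ) ∣ v := hp'.dvd_of_dvd_pow hv2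
  have h3 : (p : ℤ) ^ 2 ∣ u ^ 3 := (pow_dvd_pow_of_dvd hpu 2).trans ⟨u, by ring⟩
  have h4 : (p : ℤ) ^ 2 ∣ v ^ 2 := pow_dvd_pow_of_dvd hv 2
  exact dvd_sub h3 h4

/-- With `1728 ∣ D`: `|D| = 1728·|D/1728|` (cast to `ℝ`). -/
theorem abs_cast_eq_mul_natAbs {D : ℤ} (h : (1728 : ℤ) ∣ D) :
    ((|D| : ℤ) : ℝ) = 1728 * (((D / 1728).natAbs : ℕ) : ℝ) := by
  obtain ⟨Δ, rfl⟩ := h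
  have h1 : (1728 * Δ) / 1728 = Δ := Int.mul_ediv_cancel_left Δ (by norm_num)
  rw [h1, Nat.cast_natAbs, abs_mul]
  push_cast
  norm_num

/-- With `1728 ∣ D` and `|D| ≤ 1728·Y`: `|D/1728| ≤ Y`. -/
theorem natAbs_div_le {D : ℤ} {Y : ℝ} (h : (1728 : ℤ) ∣ D) (hle : ((|D| : ℤ) : ℝ) ≤ 1728 * Y) :
    (((D / 1728).natAbs : ℕ) : ℝ) ≤ Y := by
  rw [abs_cast_eq_mul_natAbs h] at hle
  linarith

/-- With `1728 ∣ D ≠ 0`: `D/1728 ≠ 0` (as a natural number `|D/1728| ≠ 0`). -/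
theorem natAbs_div_ne_zero {D : ℤ} (hD : D ≠ 0) (h : (1728 : ℤ) ∣ D) : (D / 1728).natAbs ≠ 0 := by
  obtain ⟨Δ, rfl⟩ := h
  rw [Int.mul_ediv_cancel_left Δ (by norm_num)]
  exact Int.natAbs_ne_zero.mpr (fun h0 => hD (by rw [h0, mul_zero]))

/-! ## 2. The datum `(e, g)` of a pair -/

/-- **The datum of a pair.** For `x = (u, v)` with `D = u³ − v² ≠ 0`, `1728 ∣ D`, `Δ = D/1728`: there are
`e, g, r ≥ 1` and `c` with `|Δ| = g·e·r`, `Δ = g·c`, `(u, c) = 1`, `e ∣ c`, every prime of `g` dividing `u`,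
`e` powerful, `r' = simpleRad x ≤ r` and `r·rad e·(rad g)² ≤ N*`. Construction: `g` = the `u`-part of
`|Δ|`, `c = sign(Δ)·|Δ|/g`, `e` = the powerful part of `|c|`, `r = |c|/e = ∏_{p ∥ c} p`. -/
theorem datum_arith (x : ℤ × ℤ) (hD : x.1 ^ 3 - x.2 ^ 2 ≠ 0) (h1728 : (1728 : ℤ) ∣ x.1 ^ 3 - x.2 ^ 2) :
    ∃ e g r : ℕ, ∃ c : ℤ, 0 < e ∧ 0 < g ∧
      ((x.1 ^ 3 - x.2 ^ 2) / 1728).natAbs = g * (e * r) ∧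
      (x.1 ^ 3 - x.2 ^ 2) / 1728 = g * c ∧ IsCoprime x.1 c ∧ (e : ℤ) ∣ c ∧
      (∀ p ∈ g.primeFactors, (p : ℤ) ∣ x.1) ∧ (∀ p ∈ e.primeFactors, p ^ 2 ∣ e) ∧
      simpleRad x ≤ r ∧
      r * (∏ p ∈ e.primeFactors, p) * (∏ p ∈ g.primeFactors, p) ^ 2 ≤ Nstar x := by
  have hS : ∀ p : ℕ, p.Prime → (p : ℤ) ∣ x.1 ^ 3 - x.2 ^ 2 → ¬ (p : ℤ) ^ 2 ∣ x.1 ^ 3 - x.2 ^ 2 →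
      ¬ (p : ℤ) ∣ x.1 := fun p hp h1 h2 => not_dvd_of_simple hp h1 h2
  unfold simpleRad Nstar
  set D : ℤ := x.1 ^ 3 - x.2 ^ 2
  obtain ⟨Δ, hΔ⟩ := h1728
  have hΔ' : D / 1728 = Δ := by rw [hΔ]; simp
  have hΔ0 : Δ ≠ 0 := by rintro rfl; exact hD (by rw [hΔ]; simp)
  rw [hΔ']
  set n : ℕ := Δ.natAbs
  have hn0 : n ≠ 0 := Int.natAbs_ne_zero.mpr hΔ0
  -- the `u`-part `g` and the `u`-coprime part `m` of `n = |Δ|`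
  set g : ℕ := ∏ p ∈ n.primeFactors.filter (fun p : ℕ => (p : ℤ) ∣ x.1), p ^ n.factorization p
  set m : ℕ := ∏ p ∈ n.primeFactors.filter (fun p : ℕ => ¬ (p : ℤ) ∣ x.1), p ^ n.factorization p
  have hgm : g * m = n := prod_primeFactors_filter_mul hn0 (fun p : ℕ => (p : ℤ) ∣ x.1)
  have hg0 : g ≠ 0 := fun h => hn0 (by rw [← hgm, h, zero_mul])
  have hm0 : m ≠ 0 := fun h => hn0 (by rw [← hgm, h, mul_zero])
  have hgPF : g.primeFactors ⊆ n.primeFactors.filter (fun p : ℕ => (p : ℤ) ∣ x.1) :=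
    Finset.subset_of_eq (primeFactors_prod_pow_factorization (Finset.filter_subset _ _))
  have hmPF : m.primeFactors ⊆ n.primeFactors.filter (fun p : ℕ => ¬ (p : ℤ) ∣ x.1) :=
    Finset.subset_of_eq (primeFactors_prod_pow_factorization (Finset.filter_subset _ _))
  have hgP : ∀ q : ℕ, q.Prime → q ∣ g → (q : ℤ) ∣ x.1 := fun q hq h =>
    (Finset.mem_filter.mp (hgPF (Nat.mem_primeFactors.mpr ⟨hq, h, hg0⟩))).2
  have hmP : ∀ q : ℕ, q.Prime → q ∣ m → ¬ (q : ℤ) ∣ x.1 := fun q hq h =>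
    (Finset.mem_filter.mp (hmPF (Nat.mem_primeFactors.mpr ⟨hq, h, hm0⟩))).2
  -- the powerful part `e` and the simple part `r` of `m`
  set e : ℕ := ∏ p ∈ m.primeFactors.filter (fun p => p ^ 2 ∣ m), p ^ m.factorization p
  set r : ℕ := ∏ p ∈ m.primeFactors.filter (fun p => ¬ p ^ 2 ∣ m), p
  have hr' : (∏ p ∈ m.primeFactors.filter (fun p => ¬ p ^ 2 ∣ m), p ^ m.factorization p) = r := by
    refine Finset.prod_congr rfl (fun p hp => ?_)
    obtain ⟨hpm, hq⟩ := Finset.mem_filter.mp hp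
    have hp := Nat.prime_of_mem_primeFactors hpm
    have h1 : 1 ≤ m.factorization p :=
      (hp.dvd_iff_one_le_factorization hm0).mp (Nat.dvd_of_mem_primeFactors hpm)
    have h2 : ¬ 2 ≤ m.factorization p := fun h => hq ((hp.pow_dvd_iff_le_factorization hm0).mpr h)
    have h3 : m.factorization p = 1 := by omega
    rw [h3, pow_one]
  have her : e * r = m := by
    rw [← hr']
    exact prod_primeFactors_filter_mul hm0 (fun p => p ^ 2 ∣ m)
  have he0 : e ≠ 0 := fun h => hm0 (by rw [← her, h, zero_mul])
  have hePF : e.primeFactors ⊆ m.primeFactors.filter (fun p => p ^ 2 ∣ m) :=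
    Finset.subset_of_eq (primeFactors_prod_pow_factorization (Finset.filter_subset _ _))
  refine ⟨e, g, r, Δ.sign * (m : ℤ), Nat.pos_of_ne_zero he0, Nat.pos_of_ne_zero hg0, ?_, ?_, ?_, ?_,
    ?_, ?_, ?_, ?_⟩
  · -- `|Δ| = g·(e·r)`
    rw [her, hgm]
  · -- `Δ = g·c`
    calc Δ = Δ.sign * (n : ℤ) := (Int.sign_mul_natAbs Δ).symm
      _ = (g : ℤ) * (Δ.sign * (m : ℤ)) := by rw [← hgm]; push_cast; ring
  · -- `(u, c) = 1`
    rw [Int.isCoprime_iff_nat_coprime]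
    have hc : (Δ.sign * (m : ℤ)).natAbs = m := by
      rw [Int.natAbs_mul, Int.natAbs_sign_of_ne_zero hΔ0, one_mul, Int.natAbs_natCast]
    rw [hc]
    exact (Nat.coprime_of_dvd fun k hk hkm hku => hmP k hk hkm (Int.ofNat_dvd_left.mpr hku)).symm
  · -- `e ∣ c`
    exact (Int.natCast_dvd_natCast.mpr (Dvd.intro r her)).mul_left _
  · -- every prime of `g` divides `u`
    exact fun p hp => hgP p (Nat.prime_of_mem_primeFactors hp) (Nat.dvd_of_mem_primeFactors hp)
  · -- `e` is powerful
    intro p hp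
    have hmem := hePF hp
    have h2 : 2 ≤ m.factorization p :=
      ((Nat.prime_of_mem_primeFactors hp).pow_dvd_iff_le_factorization hm0).mp
        (Finset.mem_filter.mp hmem).2
    exact (pow_dvd_pow p h2).trans (Finset.dvd_prod_of_mem (fun p => p ^ m.factorization p) hmem)
  · -- `r' ≤ r`: every prime `p ∥ D` divides `m` exactly once
    apply Finset.prod_le_prod_of_subset_of_one_le'
    · intro p hp
      rw [Finset.mem_filter] at hp
      obtain ⟨hpD, hsimple⟩ := hp
      have hpP : p.Prime := Nat.prime_of_mem_primeFactors hpD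
      have hpdvdD : (p : ℤ) ∣ D := Int.ofNat_dvd_left.mpr (Nat.dvd_of_mem_primeFactors hpD)
      obtain ⟨hp2, hp3⟩ := simple_prime_ne_two_three ⟨Δ, hΔ⟩ hpP hpdvdD hsimple
      have hpΔ : (p : ℤ) ∣ Δ := dvd_of_dvd_mul_1728 hpP hp2 hp3 (by rw [← hΔ]; exact hpdvdD)
      have hpn : p ∣ n := Int.ofNat_dvd_left.mp hpΔ
      have hpu : ¬ (p : ℤ) ∣ x.1 := hS p hpP hpdvdD hsimple
      have hpg : ¬ p ∣ g := fun h => hpu (hgP p hpP h)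
      have hpm : p ∣ m := ((Nat.Prime.dvd_mul hpP).mp (by rw [hgm]; exact hpn)).resolve_left hpg
      have hpm2 : ¬ p ^ 2 ∣ m := by
        intro h
        apply hsimple
        have h1 : p ^ 2 ∣ n := h.trans (Dvd.intro_left g hgm)
        have h2 : ((p ^ 2 : ℕ) : ℤ) ∣ Δ := Int.ofNat_dvd_left.mpr h1
        rw [hΔ]
        exact Dvd.dvd.mul_left (by exact_mod_cast h2) 1728
      exact Finset.mem_filter.mpr ⟨Nat.mem_primeFactors.mpr ⟨hpP, hpm, hm0⟩, hpm2⟩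
    · intro p hp _
      exact (Nat.prime_of_mem_primeFactors (Finset.mem_filter.mp hp).1).one_lt.le
  · -- `r·rad e·(rad g)² ≤ N*`
    have h1 : (∏ p ∈ e.primeFactors, p) ≤ ∏ p ∈ m.primeFactors.filter (fun p => p ^ 2 ∣ m), p :=
      Finset.prod_le_prod_of_subset_of_one_le' hePF fun p hp _ =>
        (Nat.prime_of_mem_primeFactors (Finset.mem_filter.mp hp).1).one_lt.le
    have h2 : (∏ p ∈ e.primeFactors, p) * r ≤ ∏ p ∈ m.primeFactors, p := by
      calc (∏ p ∈ e.primeFactors, p) * r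
          ≤ (∏ p ∈ m.primeFactors.filter (fun p => p ^ 2 ∣ m), p) * r := Nat.mul_le_mul_right _ h1
        _ = ∏ p ∈ m.primeFactors, p :=
          Finset.prod_filter_mul_prod_filter_not m.primeFactors (fun p => p ^ 2 ∣ m) (fun p => p)
    have h3 : (∏ p ∈ m.primeFactors, p) ≤
        ∏ p ∈ n.primeFactors.filter (fun p : ℕ => ¬ (p : ℤ) ∣ x.1), p :=
      Finset.prod_le_prod_of_subset_of_one_le' hmPF fun p hp _ =>
        (Nat.prime_of_mem_primeFactors (Finset.mem_filter.mp hp).1).one_lt.le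
    have h4 : (∏ p ∈ g.primeFactors, p) ^ 2 ≤
        ∏ p ∈ n.primeFactors.filter (fun p : ℕ => (p : ℤ) ∣ x.1), p ^ 2 := by
      rw [← Finset.prod_pow]
      exact Finset.prod_le_prod_of_subset_of_one_le' hgPF fun p hp _ =>
        Nat.one_le_pow _ _ (Nat.prime_of_mem_primeFactors (Finset.mem_filter.mp hp).1).pos
    rw [Finset.prod_ite]
    calc r * (∏ p ∈ e.primeFactors, p) * (∏ p ∈ g.primeFactors, p) ^ 2
        = ((∏ p ∈ e.primeFactors, p) * r) * (∏ p ∈ g.primeFactors, p) ^ 2 := by ring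
      _ ≤ (∏ p ∈ n.primeFactors.filter (fun p : ℕ => ¬ (p : ℤ) ∣ x.1), p) *
            ∏ p ∈ n.primeFactors.filter (fun p : ℕ => (p : ℤ) ∣ x.1), p ^ 2 :=
          Nat.mul_le_mul (h2.trans h3) h4
      _ = _ := mul_comm _ _

/-! ## 3. The cusp box is finite; class membership of a resolved pair -/

/-- `N* ≤ |Δ|²` (`N* ≤ (rad Δ)²`). -/
theorem Nstar_le_sq (x : ℤ × ℤ) (hn : ((x.1 ^ 3 - x.2 ^ 2) / 1728).natAbs ≠ 0) :
    Nstar x ≤ ((x.1 ^ 3 - x.2 ^ 2) / 1728).natAbs ^ 2 := by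
  unfold Nstar
  set n : ℕ := ((x.1 ^ 3 - x.2 ^ 2) / 1728).natAbs
  calc ∏ p ∈ n.primeFactors, (if ((p : ℕ) : ℤ) ∣ x.1 then p ^ 2 else p)
      ≤ ∏ p ∈ n.primeFactors, p ^ 2 := by
        apply Finset.prod_le_prod' (fun p hp => ?_)
        have h1 : 1 ≤ p := (Nat.prime_of_mem_primeFactors hp).one_lt.le
        split_ifs
        · exact le_rfl
        · calc p = p ^ 1 := (pow_one p).symm
            _ ≤ p ^ 2 := Nat.pow_le_pow_right h1 (by norm_num)
    _ = (∏ p ∈ n.primeFactors, p) ^ 2 := Finset.prod_pow _ _ _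
    _ ≤ n ^ 2 := Nat.pow_le_pow_left
        (Nat.le_of_dvd (Nat.pos_of_ne_zero hn) (Nat.prod_primeFactors_dvd n)) 2

/-- The conductor-free cusp box lies in the cusp set of conductor scale `Y²`. -/
theorem cuspBox_subset_cuspSetD (Y : ℝ) : cuspBox Y ⊆ cuspSetD (Y ^ 2) Y := by
  rintro x ⟨⟨hu, hv, hne, hu3, hDle, hfl⟩, h1728, hTF⟩
  refine ⟨hu, hv, hne, h1728, hTF, hu3, hDle, hfl, ?_⟩
  have hn0 := natAbs_div_ne_zero (sub_ne_zero.mpr hne) h1728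
  have h1 : (Nstar x : ℝ) ≤ ((((x.1 ^ 3 - x.2 ^ 2) / 1728).natAbs : ℕ) : ℝ) ^ 2 := by
    exact_mod_cast Nstar_le_sq x hn0
  have h2 := natAbs_div_le h1728 hDle
  have h0 : (0 : ℝ) ≤ ((((x.1 ^ 3 - x.2 ^ 2) / 1728).natAbs : ℕ) : ℝ) := Nat.cast_nonneg _
  calc (Nstar x : ℝ) ≤ _ := h1
    _ ≤ Y ^ 2 := by gcongr

/-- The conductor-free cusp box is finite (`Y ≥ 1`). -/
theorem cuspBox_finite (Y : ℝ) (hY : 1 ≤ Y) : (cuspBox Y).Finite :=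
  (cuspSetD_finite (Y ^ 2) Y hY).subset (cuspBox_subset_cuspSetD Y)

/-- **Every resolved pair lies in the class of its datum**, with `e ≤ Y` powerful and `g ≤ Y`. -/
theorem exists_mem_resolvedClass {X Y : ℝ} {x : ℤ × ℤ} (hx : x ∈ cuspSetD X Y)
    (hres : ResolvedRegimeTw Y x) :
    ∃ e ∈ (Finset.Icc 1 ⌊Y⌋₊).filter (fun e : ℕ => ∀ p ∈ e.primeFactors, p ^ 2 ∣ e),
      ∃ g ∈ Finset.Icc 1 ⌊Y⌋₊, x ∈ resolvedClass e g X Y := by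
  obtain ⟨hu0, hv0, hne, h1728, hTF, hu3, hDle, hfloor, hN⟩ := hx
  have hD : x.1 ^ 3 - x.2 ^ 2 ≠ 0 := sub_ne_zero.mpr hne
  obtain ⟨e, g, r, c, he0, hg0, hn, hgc, hcop, hec, hgu, hpow, hsr, hNstar⟩ :=
    datum_arith x hD h1728
  have hcast := abs_cast_eq_mul_natAbs h1728
  have hnY := natAbs_div_le h1728 hDle
  have hn0 := natAbs_div_ne_zero hD h1728
  set n : ℕ := ((x.1 ^ 3 - x.2 ^ 2) / 1728).natAbs
  have heY : (e : ℝ) ≤ Y := by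
    have : e ≤ n := Nat.le_of_dvd (Nat.pos_of_ne_zero hn0) ⟨g * r, by rw [hn]; ring⟩
    exact le_trans (by exact_mod_cast this) hnY
  have hgY : (g : ℝ) ≤ Y := by
    have : g ≤ n := Nat.le_of_dvd (Nat.pos_of_ne_zero hn0) ⟨e * r, hn⟩
    exact le_trans (by exact_mod_cast this) hnY
  refine ⟨e, Finset.mem_filter.mpr ⟨Finset.mem_Icc.mpr ⟨Nat.one_le_iff_ne_zero.mpr he0.ne',
      Nat.le_floor heY⟩, hpow⟩,
    g, Finset.mem_Icc.mpr ⟨Nat.one_le_iff_ne_zero.mpr hg0.ne', Nat.le_floor hgY⟩, ?_⟩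
  refine ⟨⟨⟨hu0, hv0, hne, hu3, hDle, hfloor⟩, h1728, hTF⟩, hres, hgu, ⟨c, hgc, hcop, hec⟩, ?_, ?_⟩
  · -- `Y^{1/6}·e·g ≤ |Δ|`: from `Y^{1/6} ≤ r' ≤ r` and `|Δ| = r·e·g`
    have hr : Y ^ (1 / 6 : ℝ) ≤ (r : ℝ) := hres.2.trans (by exact_mod_cast hsr)
    have hn' : (n : ℝ) = (r : ℝ) * e * g := by rw [hn]; push_cast; ring
    rw [hcast]
    calc Y ^ (1 / 6 : ℝ) * e * g ≤ (r : ℝ) * e * g := by gcongr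
      _ = 1728 * (n : ℝ) / 1728 := by rw [hn']; ring
  · -- `|Δ|·rad e·(rad g)² ≤ e·g·X`: from `|Δ| = g·e·r`, `r·rad e·(rad g)² ≤ N* ≤ X`
    set rade : ℕ := ∏ p ∈ e.primeFactors, p
    set radg : ℕ := ∏ p ∈ g.primeFactors, p
    have key : n * rade * radg ^ 2 ≤ e * g * Nstar x := by
      calc n * rade * radg ^ 2 = (e * g) * (r * rade * radg ^ 2) := by rw [hn]; ring
        _ ≤ (e * g) * Nstar x := Nat.mul_le_mul_left _ hNstar
    have key' : (n : ℝ) * rade * (radg : ℝ) ^ 2 ≤ (e : ℝ) * g * (Nstar x : ℝ) := by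
      exact_mod_cast key
    rw [hcast]
    calc 1728 * (n : ℝ) / 1728 * rade * (radg : ℝ) ^ 2 = (n : ℝ) * rade * (radg : ℝ) ^ 2 := by ring
      _ ≤ (e : ℝ) * g * (Nstar x : ℝ) := key'
      _ ≤ (e : ℝ) * g * X := by gcongr

/-! ## 4. Counting: the resolved set injects into the union of the classes -/

/-- The resolved part of the cusp set has at most `Σ_{e ≤ Y powerful} Σ_{g ≤ Y} #resolvedClass e g X Y`
members (`Y ≥ 1`). -/
theorem ncard_resolved_le_sum {X Y : ℝ} (hY : 1 ≤ Y) :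
    (Set.ncard {x : ℤ × ℤ | x ∈ cuspSetD X Y ∧ ResolvedRegimeTw Y x} : ℝ) ≤
      ∑ e ∈ (Finset.Icc 1 ⌊Y⌋₊).filter (fun e : ℕ => ∀ p ∈ e.primeFactors, p ^ 2 ∣ e),
        ∑ g ∈ Finset.Icc 1 ⌊Y⌋₊, (Set.ncard (resolvedClass e g X Y) : ℝ) := by
  set E := (Finset.Icc 1 ⌊Y⌋₊).filter (fun e : ℕ => ∀ p ∈ e.primeFactors, p ^ 2 ∣ e)
  set G := Finset.Icc 1 ⌊Y⌋₊
  have hsub : {x : ℤ × ℤ | x ∈ cuspSetD X Y ∧ ResolvedRegimeTw Y x} ⊆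
      ⋃ e ∈ E, ⋃ g ∈ G, resolvedClass e g X Y := by
    rintro x ⟨hx, hres⟩
    obtain ⟨e, he, g, hg, hmem⟩ := exists_mem_resolvedClass hx hres
    simp only [Set.mem_iUnion]
    exact ⟨e, he, g, hg, hmem⟩
  have hfin : (⋃ e ∈ E, ⋃ g ∈ G, resolvedClass e g X Y).Finite := by
    refine (cuspBox_finite Y hY).subset ?_
    intro x hx
    simp only [Set.mem_iUnion] at hx
    obtain ⟨e, -, g, -, h⟩ := hx
    exact h.1
  have h1 := Set.ncard_le_ncard hsub hfin
  have h2 : (⋃ e ∈ E, ⋃ g ∈ G, resolvedClass e g X Y).ncard ≤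
      ∑ e ∈ E, ∑ g ∈ G, (resolvedClass e g X Y).ncard :=
    (Finset.set_ncard_biUnion_le E _).trans
      (Finset.sum_le_sum fun e _ => Finset.set_ncard_biUnion_le G _)
  exact_mod_cast h1.trans h2

/-- **The resolved regime reduces to its conductor-free class sum**:
`ResolvedMissingTw → LawOn ResolvedRegimeTw` (same constant; registered sub-goal of stmt-ABC-1975,
line `deep-moduli-cusp-dispersion`). -/
theorem lawOn_resolvedRegimeTw_of_missing : ResolvedMissingTw → LawOn ResolvedRegimeTw := by
  intro h σ hσ ε hε
  obtain ⟨C, hC⟩ := h σ hσ ε hε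
  exact ⟨C, fun X Y hX hY hXY hYX => (ncard_resolved_le_sum hY).trans (hC X Y hX hY hXY hYX)⟩

end Summit.ABC.ABC.Theorems.SharpModerateLaw.CuspDispersion

end
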